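import Mathlib
import Summits.ValiantsHypothesis.ValiantsHypothesis.Theorems.FreeSubtorusOrbitDimensionBoundSignLineariseStab
import Summits.ValiantsHypothesis.ValiantsHypothesis.Theorems.FreeSubtorusOrbitDimensionBoundSignLineariseLiftAlgebra

/-!
# `OrbitDimensionBound` (stmt-ValiantsHypothesis-16133), line `sign_covering`, stub `stub_signLinearise` —
part 2b: commuting involutive lifts of commuting involutive substitutions

Setting: `B` an `m × m` matrix of polynomials over `ℂ` which is SCHURIAN (finite-order pairs `(g, h)` with
`g · B = B · h` are scalar), and `c ≠ 0` a vector.  A NORMALISED EXACT LIFT of a substitution `γ ∈ GL(σ)` is a pair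
`(g, h) ∈ GL_m × GL_m` with `B(γ · x) = g⁻¹ · B(x) · h` and `h c = c` (in the application `c` spans the kernel of the
constant part of `B`, so every exact lift can be normalised by a scalar).  By part 1 (`isNilpotent_of_stabiliser`)
every normalised lift `(u₁, u₂)` of `γ = 1` is UNIPOTENT (`unipotent_of_lift_one`).

Main result (`exists_commuting_involutive_lifts`, §5): if `γ_0, …, γ_{d-1}` are pairwise commuting involutive
substitutions each admitting a normalised exact lift, then they admit normalised exact lifts `(G_i, H_i)` which are
INVOLUTIONS and COMMUTE pairwise.  This is the characteristic-zero splitting of the extension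
`1 → (unipotent stabiliser) → (normalised lifts) → (ℤ/2)^d → 1` made explicit, with no algebraic-group theory:
* SYMMETRISE (§3): if `(p, q)` is an involutive lift of `δ` with `γδ = δγ`, replace a lift `(g, h)` of `γ` by
  `(½(g + p g p), ½(h + q h q)) = (g, h) · ½(1 + u)` with `u = (g, h)⁻¹ (p, q) (g, h) (p, q)` a normalised lift of `1`,
  hence unipotent, so `½(1 + u) = 1 + (u - 1)/2` is an invertible stabiliser: still a normalised lift of `γ`, now
  commuting with `(p, q)` (and with whatever commuted with both);
* INVOLUTISE (§4): `u = (g, h)²` is a normalised lift of `γ² = 1`, so `u = 1 + N` with `N` nilpotent; with the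
  polynomial `p`, `p² (1 + X) ≡ 1 (mod X^{K+1})` of part 2a, `w_i = p(N_i)` gives the involutive normalised lift
  `(g w₁, h w₂)` of `γ`, commuting with everything that commutes with `(g, h)`.

No new definitions; helper file for `Theorems/FreeSubtorusOrbitDimensionBoundStubSignLinearise.lean`
(`--supports stmt-ValiantsHypothesis-16133`).  Nothing here moves the crux `OrbitDimensionBound`, the route
`FreeSubtorus` or VP ≠ VNP.

## References
* [LandsbergRessayre2017] J. M. Landsberg, N. Ressayre, *Permanent v. determinant: an exponential lower bound
  assuming symmetry and a potential path towards Valiant's conjecture*, Differential Geom. Appl. 55 (2017), §6.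
* A. Borel, J.-P. Serre, *Théorèmes de finitude en cohomologie galoisienne*, Comment. Math. Helv. 39 (1964), §5
  (finite supplements to unipotent normal subgroups in characteristic `0`) — here replaced by explicit averaging.
-/

set_option linter.dupNamespace false

namespace Summit.ValiantsHypothesis.ValiantsHypothesis.Theorems.FreeSubtorusOrbitDimensionBound.SignCovering

open Matrix MvPolynomial
open Literature.Computability.AlgebraicComplexity

variable {σ : Type*} [Fintype σ] [DecidableEq σ] {m : ℕ}

/-! ### §3 Symmetrising a lift against a commuting involutive lift -/

section Steps

variable (B : Matrix (Fin m) (Fin m) (MvPolynomial σ ℂ))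
  (hS : ∀ g h : GL (Fin m) ℂ,
    (g : Matrix (Fin m) (Fin m) ℂ).map C * B = B * (h : Matrix (Fin m) (Fin m) ℂ).map C →
    IsOfFinOrder g → IsOfFinOrder h →
    ∃ c : ℂ, (g : Matrix (Fin m) (Fin m) ℂ) = c • (1 : Matrix (Fin m) (Fin m) ℂ) ∧
      (h : Matrix (Fin m) (Fin m) ℂ) = c • (1 : Matrix (Fin m) (Fin m) ℂ))
  (c : Fin m → ℂ) (hc : c ≠ 0)

include hS hc

/-- A normalised exact lift `(u₁, u₂)` of `γ = 1` is unipotent (part 1, `isNilpotent_of_stabiliser`). [folklore] -/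
theorem unipotent_of_lift_one {u₁ u₂ : GL (Fin m) ℂ}
    (e : Matrix.linSubstEntries (1 : GL σ ℂ) B = ((u₁⁻¹ : GL (Fin m) ℂ) : Matrix (Fin m) (Fin m) ℂ).map C * B *
      ((u₂ : GL (Fin m) ℂ) : Matrix (Fin m) (Fin m) ℂ).map C)
    (hn : ((u₂ : GL (Fin m) ℂ) : Matrix (Fin m) (Fin m) ℂ) *ᵥ c = c) :
    IsNilpotent ((u₁ : Matrix (Fin m) (Fin m) ℂ) - 1) ∧ IsNilpotent ((u₂ : Matrix (Fin m) (Fin m) ℂ) - 1) :=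
  isNilpotent_of_stabiliser B hS _ _ ((lift_one_iff B).1 e) c hc hn

/-- **Symmetrisation step.**  `γ, δ` commuting substitutions, `δ² = 1`; `(g, h)` a normalised lift of `γ`, `(p, q)` a
normalised lift of `δ` (an involutive one in the application).  Then `(½(g + p g p), ½(h + q h q))` is again a normalised lift of `γ` (it is
`(g, h) · ½(1 + u)` with `u = (g,h)⁻¹ (p,q) (g,h) (p,q)` a unipotent stabiliser). [folklore] -/
theorem symmetrise {γ δ : GL σ ℂ} (hγδ : γ * δ = δ * γ) (hδ : δ * δ = 1) {g h p q : GL (Fin m) ℂ}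
    (he : Matrix.linSubstEntries γ B = ((g⁻¹ : GL (Fin m) ℂ) : Matrix (Fin m) (Fin m) ℂ).map C * B *
      ((h : GL (Fin m) ℂ) : Matrix (Fin m) (Fin m) ℂ).map C)
    (hh : ((h : GL (Fin m) ℂ) : Matrix (Fin m) (Fin m) ℂ) *ᵥ c = c)
    (hf : Matrix.linSubstEntries δ B = ((p⁻¹ : GL (Fin m) ℂ) : Matrix (Fin m) (Fin m) ℂ).map C * B *
      ((q : GL (Fin m) ℂ) : Matrix (Fin m) (Fin m) ℂ).map C)
    (hq : ((q : GL (Fin m) ℂ) : Matrix (Fin m) (Fin m) ℂ) *ᵥ c = c) :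
    ∃ g' h' : GL (Fin m) ℂ,
      Matrix.linSubstEntries γ B = ((g'⁻¹ : GL (Fin m) ℂ) : Matrix (Fin m) (Fin m) ℂ).map C * B *
        ((h' : GL (Fin m) ℂ) : Matrix (Fin m) (Fin m) ℂ).map C ∧
      ((h' : GL (Fin m) ℂ) : Matrix (Fin m) (Fin m) ℂ) *ᵥ c = c ∧
      (g' : Matrix (Fin m) (Fin m) ℂ) = (1 / 2 : ℂ) • ((g : Matrix (Fin m) (Fin m) ℂ) +
        (p : Matrix (Fin m) (Fin m) ℂ) * (g : Matrix (Fin m) (Fin m) ℂ) * (p : Matrix (Fin m) (Fin m) ℂ)) ∧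
      (h' : Matrix (Fin m) (Fin m) ℂ) = (1 / 2 : ℂ) • ((h : Matrix (Fin m) (Fin m) ℂ) +
        (q : Matrix (Fin m) (Fin m) ℂ) * (h : Matrix (Fin m) (Fin m) ℂ) * (q : Matrix (Fin m) (Fin m) ℂ)) := by
  -- the commutator-like stabiliser `u = e⁻¹ f e f`
  have e1 := lift_mul B (lift_mul B (lift_mul B (lift_inv B he) hf) he) hf
  have hprod : γ⁻¹ * δ * γ * δ = 1 := by
    rw [mul_assoc γ⁻¹, ← hγδ, ← mul_assoc, inv_mul_cancel, one_mul, hδ]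
  rw [hprod] at e1
  -- normalisation of `u₂ = h⁻¹ q h q`
  have hh' : ((h⁻¹ : GL (Fin m) ℂ) : Matrix (Fin m) (Fin m) ℂ) *ᵥ c = c := by
    conv_lhs => rw [← hh]
    rw [Matrix.mulVec_mulVec, ← Units.val_mul, inv_mul_cancel, Units.val_one, Matrix.one_mulVec]
  have hn : ((h⁻¹ * q * h * q : GL (Fin m) ℂ) : Matrix (Fin m) (Fin m) ℂ) *ᵥ c = c := by
    simp only [Units.val_mul, ← Matrix.mulVec_mulVec, hq, hh, hh']
  obtain ⟨hN1, hN2⟩ := unipotent_of_lift_one B hS c hc e1 hn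
  have hint := (lift_one_iff B).1 e1
  -- the invertible stabiliser `½(1 + u) = 1 + ½(u - 1)`
  set U₁ : Matrix (Fin m) (Fin m) ℂ := ((g⁻¹ * p * g * p : GL (Fin m) ℂ) : Matrix (Fin m) (Fin m) ℂ) with hU₁
  set U₂ : Matrix (Fin m) (Fin m) ℂ := ((h⁻¹ * q * h * q : GL (Fin m) ℂ) : Matrix (Fin m) (Fin m) ℂ) with hU₂
  have hW₁u : IsUnit (1 + (1 / 2 : ℂ) • (U₁ - 1)) := (hN1.smul (1 / 2 : ℂ)).isUnit_one_add
  have hW₂u : IsUnit (1 + (1 / 2 : ℂ) • (U₂ - 1)) := (hN2.smul (1 / 2 : ℂ)).isUnit_one_add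
  have hWeq : ∀ U : Matrix (Fin m) (Fin m) ℂ, 1 + (1 / 2 : ℂ) • (U - 1) = (1 / 2 : ℂ) • 1 + (1 / 2 : ℂ) • U := by
    intro U; module
  have hWint : (1 + (1 / 2 : ℂ) • (U₁ - 1)).map C * B = B * (1 + (1 / 2 : ℂ) • (U₂ - 1)).map C := by
    rw [hWeq, hWeq]
    exact intertwine_add B (intertwine_smul B (intertwine_one B) _) (intertwine_smul B hint _)
  -- the new pair
  refine ⟨g * hW₁u.unit, h * hW₂u.unit, ?_, ?_, ?_, ?_⟩
  · have := lift_mul B he ((lift_one_iff B (g := hW₁u.unit) (h := hW₂u.unit)).2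
      (by rw [IsUnit.unit_spec, IsUnit.unit_spec]; exact hWint))
    rwa [mul_one] at this
  · rw [Units.val_mul, IsUnit.unit_spec, ← Matrix.mulVec_mulVec, hWeq, Matrix.add_mulVec, Matrix.smul_mulVec,
      Matrix.smul_mulVec, Matrix.one_mulVec, hn, ← add_smul]
    norm_num
    exact hh
  · rw [Units.val_mul, IsUnit.unit_spec, hWeq, Matrix.mul_add, Matrix.mul_smul, Matrix.mul_smul, Matrix.mul_one,
      hU₁, Units.val_mul, Units.val_mul, Units.val_mul, ← smul_add]
    congr 1
    rw [← Matrix.mul_assoc, ← Matrix.mul_assoc, ← Matrix.mul_assoc, ← Units.val_mul, mul_inv_cancel,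
      Units.val_one, Matrix.one_mul]
  · rw [Units.val_mul, IsUnit.unit_spec, hWeq, Matrix.mul_add, Matrix.mul_smul, Matrix.mul_smul, Matrix.mul_one,
      hU₂, Units.val_mul, Units.val_mul, Units.val_mul, ← smul_add]
    congr 1
    rw [← Matrix.mul_assoc, ← Matrix.mul_assoc, ← Matrix.mul_assoc, ← Units.val_mul, mul_inv_cancel,
      Units.val_one, Matrix.one_mul]

omit hS hc in
/-- The symmetrised matrix `½(g + p g p)` commutes with the involution `p`. [folklore] -/
theorem commute_symmetrised {g p : Matrix (Fin m) (Fin m) ℂ} (hp : p * p = 1) :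
    Commute p ((1 / 2 : ℂ) • (g + p * g * p)) := by
  refine Commute.smul_right ?_ _
  change p * (g + p * g * p) = (g + p * g * p) * p
  rw [Matrix.mul_add, Matrix.add_mul, ← Matrix.mul_assoc, ← Matrix.mul_assoc, hp, Matrix.one_mul,
    Matrix.mul_assoc (p * g) p p, hp, Matrix.mul_one, add_comm]

omit hS hc in
/-- … and with everything commuting with both `g` and `p`. [folklore] -/
theorem commute_symmetrised_of_commute {g p r : Matrix (Fin m) (Fin m) ℂ} (hg : Commute r g) (hp : Commute r p) :
    Commute r ((1 / 2 : ℂ) • (g + p * g * p)) :=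
  Commute.smul_right (hg.add_right ((hp.mul_right hg).mul_right hp)) _

/-! ### §4 Involutising a lift of an involution -/

/-- **Involutisation step.**  `γ` an involutive substitution and `(g, h)` a normalised lift of `γ`.  Then `(g, h)²`
is a normalised lift of `1`, hence `1 + N` with `N` nilpotent, and `(g w₁, h w₂)` with `w_i = p(N_i)`,
`p² (1 + X) ≡ 1`, is an INVOLUTIVE normalised lift of `γ` commuting with whatever commutes with `(g, h)`.
[folklore] -/
theorem involutise {γ : GL σ ℂ} (hγ : γ * γ = 1) {g h : GL (Fin m) ℂ}
    (he : Matrix.linSubstEntries γ B = ((g⁻¹ : GL (Fin m) ℂ) : Matrix (Fin m) (Fin m) ℂ).map C * B *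
      ((h : GL (Fin m) ℂ) : Matrix (Fin m) (Fin m) ℂ).map C)
    (hh : ((h : GL (Fin m) ℂ) : Matrix (Fin m) (Fin m) ℂ) *ᵥ c = c) :
    ∃ g' h' : GL (Fin m) ℂ,
      Matrix.linSubstEntries γ B = ((g'⁻¹ : GL (Fin m) ℂ) : Matrix (Fin m) (Fin m) ℂ).map C * B *
        ((h' : GL (Fin m) ℂ) : Matrix (Fin m) (Fin m) ℂ).map C ∧
      ((h' : GL (Fin m) ℂ) : Matrix (Fin m) (Fin m) ℂ) *ᵥ c = c ∧ g' * g' = 1 ∧ h' * h' = 1 ∧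
      (∀ r : Matrix (Fin m) (Fin m) ℂ, Commute r (g : Matrix (Fin m) (Fin m) ℂ) →
        Commute r (g' : Matrix (Fin m) (Fin m) ℂ)) ∧
      (∀ r : Matrix (Fin m) (Fin m) ℂ, Commute r (h : Matrix (Fin m) (Fin m) ℂ) →
        Commute r (h' : Matrix (Fin m) (Fin m) ℂ)) := by
  -- `(g, h)²` is a normalised lift of `1`
  have e1 := lift_mul B he he
  rw [hγ] at e1
  have hn : ((h * h : GL (Fin m) ℂ) : Matrix (Fin m) (Fin m) ℂ) *ᵥ c = c := by
    rw [Units.val_mul, ← Matrix.mulVec_mulVec, hh, hh]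
  obtain ⟨hN1, hN2⟩ := unipotent_of_lift_one B hS c hc e1 hn
  have hint := (lift_one_iff B).1 e1
  -- a common nilpotency exponent and the polynomial square root `p`, `p² (1 + X) ≡ 1 (mod X^{k₁+k₂+1})`
  obtain ⟨k₁, hk₁⟩ := hN1
  obtain ⟨k₂, hk₂⟩ := hN2
  set N₁ : Matrix (Fin m) (Fin m) ℂ := ((g * g : GL (Fin m) ℂ) : Matrix (Fin m) (Fin m) ℂ) - 1 with hN₁
  set N₂ : Matrix (Fin m) (Fin m) ℂ := ((h * h : GL (Fin m) ℂ) : Matrix (Fin m) (Fin m) ℂ) - 1 with hN₂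
  have hK1 : N₁ ^ (k₁ + k₂ + 1) = 0 := pow_eq_zero_of_le (by omega) hk₁
  have hK2 : N₂ ^ (k₁ + k₂ + 1) = 0 := pow_eq_zero_of_le (by omega) hk₂
  obtain ⟨p, q, hpq, hp0⟩ := exists_sq_mul_one_add_X (k₁ + k₂)
  -- evaluate the identity on both sides
  have hev : ∀ (G : GL (Fin m) ℂ) (N : Matrix (Fin m) (Fin m) ℂ),
      N = ((G * G : GL (Fin m) ℂ) : Matrix (Fin m) (Fin m) ℂ) - 1 → N ^ (k₁ + k₂ + 1) = 0 →
      Polynomial.aeval N p * Polynomial.aeval N p * ((G : Matrix (Fin m) (Fin m) ℂ) * (G : Matrix (Fin m) (Fin m) ℂ)) = 1 ∧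
      (∀ r : Matrix (Fin m) (Fin m) ℂ, Commute r (G : Matrix (Fin m) (Fin m) ℂ) → Commute r (Polynomial.aeval N p)) := by
    intro G N hNdef hNK
    have hGG : (G : Matrix (Fin m) (Fin m) ℂ) * (G : Matrix (Fin m) (Fin m) ℂ) = 1 + N := by
      rw [hNdef, Units.val_mul, add_sub_cancel]
    refine ⟨?_, fun r hr => ?_⟩
    · have := congrArg (Polynomial.aeval N) hpq
      rw [map_mul, map_mul, map_add, map_one, Polynomial.aeval_X, map_add, map_one, map_mul, map_pow,
        Polynomial.aeval_X, hNK, zero_mul, add_zero] at this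
      rw [hGG]; exact this
    · refine commute_aeval_of_commute ?_ p
      rw [hNdef, Units.val_mul]
      exact (hr.mul_right hr).sub_right (Commute.one_right r)
  obtain ⟨hw₁, hc₁⟩ := hev g N₁ hN₁ hK1
  obtain ⟨hw₂, hc₂⟩ := hev h N₂ hN₂ hK2
  -- package `w_i` as units and `g w₁`, `h w₂` as involutions
  have pack : ∀ (G : GL (Fin m) ℂ) (w : Matrix (Fin m) (Fin m) ℂ),
      w * w * ((G : Matrix (Fin m) (Fin m) ℂ) * (G : Matrix (Fin m) (Fin m) ℂ)) = 1 →
      (∀ r : Matrix (Fin m) (Fin m) ℂ, Commute r (G : Matrix (Fin m) (Fin m) ℂ) → Commute r w) →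
      ∃ wu : GL (Fin m) ℂ, (wu : Matrix (Fin m) (Fin m) ℂ) = w ∧ (G * wu) * (G * wu) = 1 ∧
        (∀ r : Matrix (Fin m) (Fin m) ℂ, Commute r (G : Matrix (Fin m) (Fin m) ℂ) →
          Commute r ((G * wu : GL (Fin m) ℂ) : Matrix (Fin m) (Fin m) ℂ)) := by
    intro G w hw hcomm
    have hGw : Commute (G : Matrix (Fin m) (Fin m) ℂ) w := hcomm _ (Commute.refl _)
    have hGGw : Commute ((G : Matrix (Fin m) (Fin m) ℂ) * (G : Matrix (Fin m) (Fin m) ℂ)) w := hGw.mul_left hGw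
    have hinv1 : w * (w * ((G : Matrix (Fin m) (Fin m) ℂ) * (G : Matrix (Fin m) (Fin m) ℂ))) = 1 := by
      rw [← Matrix.mul_assoc]; exact hw
    have hinv2 : w * ((G : Matrix (Fin m) (Fin m) ℂ) * (G : Matrix (Fin m) (Fin m) ℂ)) * w = 1 := by
      rw [Matrix.mul_assoc, hGGw.eq, ← Matrix.mul_assoc]; exact hw
    refine ⟨⟨w, w * ((G : Matrix (Fin m) (Fin m) ℂ) * (G : Matrix (Fin m) (Fin m) ℂ)), hinv1, hinv2⟩, rfl, ?_,
      fun r hr => ?_⟩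
    · ext1
      rw [Units.val_mul, Units.val_mul, Units.val_one]
      change (G : Matrix (Fin m) (Fin m) ℂ) * w * ((G : Matrix (Fin m) (Fin m) ℂ) * w) = 1
      calc (G : Matrix (Fin m) (Fin m) ℂ) * w * ((G : Matrix (Fin m) (Fin m) ℂ) * w)
          = (G : Matrix (Fin m) (Fin m) ℂ) * (w * (G : Matrix (Fin m) (Fin m) ℂ)) * w := by
            simp only [Matrix.mul_assoc]
        _ = (G : Matrix (Fin m) (Fin m) ℂ) * ((G : Matrix (Fin m) (Fin m) ℂ) * w) * w := by rw [hGw.eq]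
        _ = w * ((G : Matrix (Fin m) (Fin m) ℂ) * (G : Matrix (Fin m) (Fin m) ℂ)) * w := by
            rw [← Matrix.mul_assoc, ← hGGw.eq]
        _ = 1 := hinv2
    · rw [Units.val_mul]
      exact hr.mul_right (hcomm r hr)
  obtain ⟨w₁, hw₁v, hinv₁, hcomm₁⟩ := pack g _ hw₁ hc₁
  obtain ⟨w₂, hw₂v, hinv₂, hcomm₂⟩ := pack h _ hw₂ hc₂
  -- `(w₁, w₂)` is a normalised lift of `1`
  have hN12 : N₁.map C * B = B * N₂.map C := by
    rw [hN₁, hN₂]; exact intertwine_sub B hint (intertwine_one B)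
  have hwint : (w₁ : Matrix (Fin m) (Fin m) ℂ).map C * B = B * (w₂ : Matrix (Fin m) (Fin m) ℂ).map C := by
    rw [hw₁v, hw₂v]; exact intertwine_aeval B hN12 p
  have hw₂c : ((w₂ : GL (Fin m) ℂ) : Matrix (Fin m) (Fin m) ℂ) *ᵥ c = c := by
    have hN₂c : N₂ *ᵥ c = 0 := by rw [hN₂, Matrix.sub_mulVec, hn, Matrix.one_mulVec, sub_self]
    rw [hw₂v, aeval_mulVec_of_mulVec_eq_zero hN₂c, hp0, one_smul]
  refine ⟨g * w₁, h * w₂, ?_, ?_, hinv₁, hinv₂, hcomm₁, hcomm₂⟩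
  · have := lift_mul B he ((lift_one_iff B).2 hwint)
    rwa [mul_one] at this
  · rw [Units.val_mul, ← Matrix.mulVec_mulVec, hw₂c, hh]

/-! ### §5 Commuting involutive lifts of commuting involutive substitutions -/

/-- **Commuting involutive normalised lifts.**  If `γ_0, …, γ_{d-1}` are pairwise commuting involutive
substitutions, each with a normalised exact lift, then there are normalised exact lifts `(G_i, H_i)` of the `γ_i`
which are involutions and commute pairwise (induction on `i`: symmetrise a lift of `γ_i` against the involutions
already built, then involutise it). [folklore] -/
theorem exists_commuting_involutive_lifts {d : ℕ} (γ : Fin d → GL σ ℂ)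
    (hγc : ∀ i j, γ i * γ j = γ j * γ i) (hγ2 : ∀ i, γ i * γ i = 1)
    (hex : ∀ i, ∃ g h : GL (Fin m) ℂ,
      Matrix.linSubstEntries (γ i) B = ((g⁻¹ : GL (Fin m) ℂ) : Matrix (Fin m) (Fin m) ℂ).map C * B *
        ((h : GL (Fin m) ℂ) : Matrix (Fin m) (Fin m) ℂ).map C ∧
      ((h : GL (Fin m) ℂ) : Matrix (Fin m) (Fin m) ℂ) *ᵥ c = c) :
    ∃ G H : Fin d → GL (Fin m) ℂ,
      (∀ i, Matrix.linSubstEntries (γ i) B = (((G i)⁻¹ : GL (Fin m) ℂ) : Matrix (Fin m) (Fin m) ℂ).map C * B *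
        ((H i : GL (Fin m) ℂ) : Matrix (Fin m) (Fin m) ℂ).map C) ∧
      (∀ i, ((H i : GL (Fin m) ℂ) : Matrix (Fin m) (Fin m) ℂ) *ᵥ c = c) ∧
      (∀ i, G i * G i = 1) ∧ (∀ i, H i * H i = 1) ∧
      (∀ i j, Commute (G i) (G j)) ∧ (∀ i j, Commute (H i) (H j)) := by
  -- `P k`: good lifts for the indices below `k`
  have main : ∀ k : ℕ, k ≤ d → ∃ G H : Fin d → GL (Fin m) ℂ,
      (∀ i : Fin d, (i : ℕ) < k →
        Matrix.linSubstEntries (γ i) B = (((G i)⁻¹ : GL (Fin m) ℂ) : Matrix (Fin m) (Fin m) ℂ).map C * B *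
          ((H i : GL (Fin m) ℂ) : Matrix (Fin m) (Fin m) ℂ).map C ∧
        ((H i : GL (Fin m) ℂ) : Matrix (Fin m) (Fin m) ℂ) *ᵥ c = c ∧ G i * G i = 1 ∧ H i * H i = 1) ∧
      (∀ i j : Fin d, (i : ℕ) < k → (j : ℕ) < k → Commute (G i) (G j) ∧ Commute (H i) (H j)) := by
    intro k
    induction k with
    | zero =>
      intro _
      exact ⟨fun _ => 1, fun _ => 1, fun i hi => absurd hi (Nat.not_lt_zero _),
        fun i j hi => absurd hi (Nat.not_lt_zero _)⟩
    | succ k ih =>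
      intro hk
      obtain ⟨G, H, hGH, hcomm⟩ := ih (Nat.le_of_succ_le hk)
      let i₀ : Fin d := ⟨k, hk⟩
      -- symmetrise an initial lift of `γ i₀` against `(G j, H j)`, `j < k`
      have sym : ∀ j : ℕ, j ≤ k → ∃ g h : GL (Fin m) ℂ,
          Matrix.linSubstEntries (γ i₀) B = ((g⁻¹ : GL (Fin m) ℂ) : Matrix (Fin m) (Fin m) ℂ).map C * B *
            ((h : GL (Fin m) ℂ) : Matrix (Fin m) (Fin m) ℂ).map C ∧
          ((h : GL (Fin m) ℂ) : Matrix (Fin m) (Fin m) ℂ) *ᵥ c = c ∧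
          ∀ i : Fin d, (i : ℕ) < j →
            Commute ((G i : GL (Fin m) ℂ) : Matrix (Fin m) (Fin m) ℂ) (g : Matrix (Fin m) (Fin m) ℂ) ∧
            Commute ((H i : GL (Fin m) ℂ) : Matrix (Fin m) (Fin m) ℂ) (h : Matrix (Fin m) (Fin m) ℂ) := by
        intro j
        induction j with
        | zero =>
          intro _
          obtain ⟨g, h, he, hh⟩ := hex i₀
          exact ⟨g, h, he, hh, fun i hi => absurd hi (Nat.not_lt_zero _)⟩
        | succ j ihj =>
          intro hj
          obtain ⟨g, h, he, hh, hcij⟩ := ihj (Nat.le_of_succ_le hj)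
          let i₁ : Fin d := ⟨j, by omega⟩
          have hi₁ : (i₁ : ℕ) < k := by change j < k; omega
          obtain ⟨hf, hq, hp2, hq2⟩ := hGH i₁ hi₁
          obtain ⟨g', h', he', hh', hg', hh''⟩ := symmetrise B hS c hc (hγc i₀ i₁) (hγ2 i₁) he hh hf hq
          have hp2m : ((G i₁ : GL (Fin m) ℂ) : Matrix (Fin m) (Fin m) ℂ) * ((G i₁ : GL (Fin m) ℂ) : Matrix _ _ ℂ) = 1 := by
            rw [← Units.val_mul, hp2, Units.val_one]
          have hq2m : ((H i₁ : GL (Fin m) ℂ) : Matrix (Fin m) (Fin m) ℂ) * ((H i₁ : GL (Fin m) ℂ) : Matrix _ _ ℂ) = 1 := by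
            rw [← Units.val_mul, hq2, Units.val_one]
          refine ⟨g', h', he', hh', fun i hi => ?_⟩
          rcases Nat.lt_succ_iff_lt_or_eq.1 hi with hlt | heq
          · obtain ⟨c1, c2⟩ := hcij i hlt
            obtain ⟨d1, d2⟩ := hcomm i i₁ (by omega) hi₁
            refine ⟨?_, ?_⟩
            · rw [hg']; exact commute_symmetrised_of_commute c1 (Commute.units_val_iff.2 d1)
            · rw [hh'']; exact commute_symmetrised_of_commute c2 (Commute.units_val_iff.2 d2)
          · have hii : i = i₁ := Fin.ext heq
            rw [hii]
            refine ⟨?_, ?_⟩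
            · rw [hg']; exact commute_symmetrised hp2m
            · rw [hh'']; exact commute_symmetrised hq2m
      obtain ⟨g, h, he, hh, hcij⟩ := sym k le_rfl
      -- involutise
      obtain ⟨g', h', he', hh', hg2, hh2, htg, hth⟩ := involutise B hS c hc (hγ2 i₀) he hh
      refine ⟨Function.update G i₀ g', Function.update H i₀ h', fun i hi => ?_, fun i j hi hj => ?_⟩
      · rcases Nat.lt_succ_iff_lt_or_eq.1 hi with hlt | heq
        · have hne : i ≠ i₀ := fun hh0 => by rw [hh0] at hlt; exact lt_irrefl _ hlt
          simp only [Function.update_of_ne hne]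
          exact hGH i hlt
        · have hii : i = i₀ := Fin.ext heq
          subst hii
          simp only [Function.update_self]
          exact ⟨he', hh', hg2, hh2⟩
      · -- commutation below `k + 1`
        have old_new : ∀ i : Fin d, (i : ℕ) < k → Commute (G i) g' ∧ Commute (H i) h' := fun i hi =>
          ⟨Commute.units_val_iff.1 (htg _ (hcij i hi).1), Commute.units_val_iff.1 (hth _ (hcij i hi).2)⟩
        by_cases hi0 : i = i₀
        · by_cases hj0 : j = i₀
          · rw [hi0, hj0]
            exact ⟨Commute.refl _, Commute.refl _⟩
          · have hjlt : (j : ℕ) < k := by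
              rcases Nat.lt_succ_iff_lt_or_eq.1 hj with hlt | heq
              · exact hlt
              · exact absurd (Fin.ext heq) hj0
            rw [hi0]
            simp only [Function.update_self, Function.update_of_ne hj0]
            exact ⟨(old_new j hjlt).1.symm, (old_new j hjlt).2.symm⟩
        · have hilt : (i : ℕ) < k := by
            rcases Nat.lt_succ_iff_lt_or_eq.1 hi with hlt | heq
            · exact hlt
            · exact absurd (Fin.ext heq) hi0
          by_cases hj0 : j = i₀
          · rw [hj0]
            simp only [Function.update_self, Function.update_of_ne hi0]
            exact old_new i hilt
          · have hjlt : (j : ℕ) < k := by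
              rcases Nat.lt_succ_iff_lt_or_eq.1 hj with hlt | heq
              · exact hlt
              · exact absurd (Fin.ext heq) hj0
            simp only [Function.update_of_ne hi0, Function.update_of_ne hj0]
            exact hcomm i j hilt hjlt
  obtain ⟨G, H, hGH, hcomm⟩ := main d le_rfl
  exact ⟨G, H, fun i => (hGH i i.2).1, fun i => (hGH i i.2).2.1, fun i => (hGH i i.2).2.2.1,
    fun i => (hGH i i.2).2.2.2, fun i j => (hcomm i j i.2 j.2).1, fun i j => (hcomm i j i.2 j.2).2⟩

end Steps

end Summit.ValiantsHypothesis.ValiantsHypothesis.Theorems.FreeSubtorusOrbitDimensionBound.SignCovering
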